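import Summits.QuantumFields.YangMills.Theorems.BalabanUVNodesN21ChiSlotCubeGeometry
import Literature.MathematicalPhysics.QuantumFieldTheory.Balaban1983to89.B15Claim189CubePin

/-!
# N21 (NE7c), strategy s3 «alternative currency», file 33 — THE ENTROPY COUNT OF THE GEOMETRIC ON-SET: at most `(2n+1)^d` cubes of def-R's `LM₂R_k`-partition have
# their `n`-layer enlargement `□^{≈n}` through a given site, hence the ON-set of files 31∕32 («`□^{≈7}` meets `Z′`») has at most `15^d ×` (number of cubes
# meeting `Z′`) members — the combinatorial factor of the (0.3) sum, in def-R's letters, on the torus (`s ∣ N₀`)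

HEADER — WORK-UNIT METADATA.  Seat `pub-ymgap-dag-n21-e` (R141 (C) fan-out, node N21 = NE7c, strategy s3), g10, file 33; companion of files 31 (`…N21ReadSetDisj`: the OFF-set
of KT-28 is «`□^{≈7} ∩ Z = ∅`») and 32 (`…N21RStepMarginalsBgN`); the ON senders enter file 23 §3's `δ_loc := Σ_{a ON} sup rratio` through their NUMBER, which this
file bounds by the number of cubes meeting `Z`.  Lane: `--kind proof --supports stmt-QuantumFields-20509 --as helper` (K3⁶ `SpineGivenEndpointR13SepCoPR`).  Count-neutral.

THE CONTENT ([folklore] torus index arithmetic over def-R's `cubeIndices` ∕ `cubeEnl` and the Claim (1.89) cube-pin module's `cubeOfSite`).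
§1 `cubeIdx_mem_idxCollar`: a cover point of the `n·s`-collar `cubeExt s c (n s)` has cube index within `n` of `c` coordinatewise.
§2 ★ `exists_offset_of_mem_cubeEnl`: ON THE TORUS with `s ∣ N₀` (`q := N₀ ∕ s` cubes per direction): if `z ∈ cubeEnl s c n` and `c` is a partition index, then
   `c_i = (cubeOfSite s z _i + e_i) mod q` for an offset `e ∈ [−n, n]^d` (deck transformations shift cube indices by multiples of `q`, r11 `cubeIdx_add_pmul`);
   `eq_cubeOfSite_of_mem_cubeEnl_zero`: at `n = 0` the cube through `z` IS `cubeOfSite s z`.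
§3 ★ `card_cubes_enl_mem_le`: for a fixed site, `#{c ∈ cubeIndices | z ∈ □_c^{≈n}} ≤ (2n+1)^d`; ★★ `card_onCubes_le`: for a site set `Z`,
   `#{c | □_c^{≈n} meets Z} ≤ (2n+1)^d · #{c | □_c meets Z}` (`Finset.card_biUnion_le` over the meeting cubes); `card_onCubes_seven_le`: the instance `n = 7`,
   `15^d`, of files 31∕32's ON-set.

HONEST FRAMING.  NE7c is NOT PRINTED and NOT PROVED.  Pure counting; the SMALL FACTOR per ON sender (print p. 176 L18–26, lens Card 30) is NOT touched — only the
number of ON cubes is bounded, in def-R's letters, by the size of `Z′` measured in cubes.  Nothing of Bałaban's asserted; N21 NOT discharged; counts UNMOVED;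
count-neutral; one finite 𝕋⁴ at fixed `ε`; NOT ℝ⁴ ∕ OS ∕ mass gap ∕ Clay.

CITATION HEADER (lean-in-tree rule 2026-08-18).  BY NAME: def-R `Node00.cubeIndices` ∕ `cubeEnl`; Claim (1.89) cube-pin module `B15Claim189CubePin.cubeOfSite` ∕
`cubeOfSite_mem_cubeIndices` ∕ `mem_cubeEnl_cubeOfSite`; r11 `B14DomainGeom.cubeIdx` ∕ `cubeIdx_le` ∕ `lt_cubeIdx`, `B14.Eq213MaximalDomains.cubeExt`,
`B14.Eq213DetSet.cubeIdx_add_pmul`; `B15Eq112TorusCover.cover` ∕ `lift` ∕ `per` ∕ `cover_lift` ∕ `cover_eq_cover_iff`; `B15LatticeCubeTorus.pmul`.  Context only (SHAPE,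
nothing asserted): [Balaban1988Convergent] (2.17) p. 257; [Balaban1989LargeFieldI] (0.3) p. 176.
-/

set_option autoImplicit false

open Set

namespace Summit.QuantumFields.YangMills.Theorems.N21OnCubeCount

open Literature.MathematicalPhysics.QuantumFieldTheory.Balaban1983to89
open B14.Eq213DetSet B14.Eq213MaximalDomains B15Eq112TorusCover B14DomainGeom
open B15LatticeCubeTorus (pmul)
open B15Claim189CubePin (cubeOfSite cubeOfSite_mem_cubeIndices mem_cubeEnl_cubeOfSite)

variable {P : Params}

/-! ## §1 Cube indices of collar points -/

/-- (C1) A cover point of the `n·s`-collar of the `s`-cube of index `c` has cube index within `n` of `c` coordinatewise. [folklore] -/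
theorem cubeIdx_mem_idxCollar {s : ℕ} (hs : 0 < s) {c x : Pt P.d} {n : ℕ} (hx : x ∈ cubeExt s c ((n * s : ℕ) : ℤ)) (i : Fin P.d) :
    c i - n ≤ cubeIdx s x i ∧ cubeIdx s x i ≤ c i + n := by
  have hs' : (0 : ℤ) < s := by exact_mod_cast hs
  obtain ⟨h1, h2⟩ := hx i
  push_cast at h1 h2
  unfold cubeIdx
  constructor
  · apply Int.le_ediv_of_mul_le hs'
    linarith
  · have h3 : x i < (c i + n + 1) * (s : ℤ) := by linarith
    have h4 := Int.ediv_lt_of_lt_mul hs' h3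
    omega

/-- (C2) The partition indices are the integer vectors of `[0, q)^d`, `q = ⌈N₀ ∕ s⌉`; for `s ∣ N₀`, `q = N₀ ∕ s`. [cite: Balaban1988Convergent, (2.17) p.257 (bookkeeping)] -/
theorem mem_cubeIndices_iff {s : ℕ} (hs : 0 < s) (hdiv : s ∣ P.sitesPerDir 0) (c : Pt P.d) :
    c ∈ Node00.cubeIndices P s ↔ ∀ i, 0 ≤ c i ∧ c i < ((P.sitesPerDir 0 / s : ℕ) : ℤ) := by
  have hq : (P.sitesPerDir 0 + s - 1) / s = P.sitesPerDir 0 / s := by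
    obtain ⟨t, ht⟩ := hdiv
    rw [ht, Nat.mul_div_cancel_left t hs, show s * t + s - 1 = (s - 1) + s * t by omega, Nat.add_mul_div_left _ _ hs,
      Nat.div_eq_of_lt (by omega : s - 1 < s), zero_add]
  unfold Node00.cubeIndices
  rw [Fintype.mem_piFinset, hq]
  refine forall_congr' fun i => ?_
  rw [Finset.mem_image]
  constructor
  · rintro ⟨m, hm, hmi⟩
    rw [Finset.mem_range] at hm
    rw [← hmi]
    exact ⟨by exact_mod_cast Nat.zero_le m, by exact_mod_cast hm⟩
  · rintro ⟨h0, hlt⟩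
    refine ⟨(c i).toNat, ?_, ?_⟩
    · rw [Finset.mem_range]
      have := Int.toNat_lt h0 |>.2 hlt
      exact_mod_cast this
    · exact Int.toNat_of_nonneg h0

/-! ## §2 On the torus: the cubes whose enlargement passes through a site are the index-translates of the site's own cube -/

/-- ★ (C3) **THE CUBES THROUGH A SITE, UP TO `n` LAYERS**: on the torus with `s ∣ N₀`, if `z ∈ cubeEnl s c n` for a partition index `c`, then `c` is the reduction
mod `q = N₀ ∕ s` of `cubeOfSite s z + e` for an offset `e ∈ [−n, n]^d` (a deck transformation shifts cube indices by a multiple of `q`, r11 `cubeIdx_add_pmul`).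
[cite: Balaban1988Convergent, (2.17) p.257 (bookkeeping)] -/
theorem exists_offset_of_mem_cubeEnl {s : ℕ} (hs : 0 < s) (hdiv : s ∣ P.sitesPerDir 0) {c : Pt P.d} (hc : c ∈ Node00.cubeIndices P s)
    {n : ℕ} {z : Site P 0} (hz : z ∈ Node00.cubeEnl P s c n) :
    ∃ e : Pt P.d, (∀ i, -(n : ℤ) ≤ e i ∧ e i ≤ n) ∧ ∀ i, c i = (cubeOfSite s z i + e i) % ((P.sitesPerDir 0 / s : ℕ) : ℤ) := by
  obtain ⟨x, hx, hxz⟩ := hz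
  obtain ⟨v, hv⟩ := (cover_eq_cover_iff (lift P z) x).1 (by rw [cover_lift, hxz])
  have hidx : ∀ i, cubeIdx s x i = cubeOfSite s z i + ((P.sitesPerDir 0 / s : ℕ) : ℤ) * v i := fun i => by
    rw [hv]
    exact cubeIdx_add_pmul (Pv := per P) (fun _ => hdiv) hs (lift P z) v i
  have hcq := (mem_cubeIndices_iff hs hdiv c).1 hc
  refine ⟨fun i => c i - cubeIdx s x i, fun i => ?_, fun i => ?_⟩
  · have h := cubeIdx_mem_idxCollar hs hx i
    constructor <;> linarith [h.1, h.2]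
  · have h1 : cubeOfSite s z i + (c i - cubeIdx s x i) = c i + ((P.sitesPerDir 0 / s : ℕ) : ℤ) * (-v i) := by
      rw [hidx i]; ring
    rw [h1, Int.add_mul_emod_self_left, Int.emod_eq_of_lt (hcq i).1 (hcq i).2]

/-- (C3₀) At `n = 0`: on the torus with `s ∣ N₀`, the partition cube through `z` IS `cubeOfSite s z`. [cite: Balaban1988Convergent, (2.17) p.257 (bookkeeping)] -/
theorem eq_cubeOfSite_of_mem_cubeEnl_zero {s : ℕ} (hs : 0 < s) (hdiv : s ∣ P.sitesPerDir 0) {c : Pt P.d} (hc : c ∈ Node00.cubeIndices P s)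
    {z : Site P 0} (hz : z ∈ Node00.cubeEnl P s c 0) : c = cubeOfSite s z := by
  obtain ⟨e, he, hce⟩ := exists_offset_of_mem_cubeEnl hs hdiv hc hz
  have hcz := (mem_cubeIndices_iff hs hdiv _).1 (cubeOfSite_mem_cubeIndices s hs z)
  funext i
  have he0 : e i = 0 := by have := he i; push_cast at this; omega
  rw [hce i, he0, add_zero, Int.emod_eq_of_lt (hcz i).1 (hcz i).2]

/-! ## §3 Counting -/

/-- ★ (C4) **AT MOST `(2n+1)^d` CUBES HAVE THEIR `n`-LAYER ENLARGEMENT THROUGH A GIVEN SITE** (torus, `s ∣ N₀`): the set of such partition indices is the image of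
the offset box `[−n, n]^d`. [cite: Balaban1988Convergent, (2.17) p.257 (bookkeeping)] -/
theorem card_cubes_enl_mem_le {s : ℕ} (hs : 0 < s) (hdiv : s ∣ P.sitesPerDir 0) (n : ℕ) (z : Site P 0)
    [DecidablePred fun c : Pt P.d => z ∈ Node00.cubeEnl P s c n] :
    ((Node00.cubeIndices P s).filter fun c => z ∈ Node00.cubeEnl P s c n).card ≤ (2 * n + 1) ^ P.d := by
  classical
  set box : Finset (Pt P.d) := Fintype.piFinset fun _ : Fin P.d => Finset.Icc (-(n : ℤ)) n with hbox
  set img : Pt P.d → Pt P.d := fun e i => (cubeOfSite s z i + e i) % ((P.sitesPerDir 0 / s : ℕ) : ℤ) with himg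
  have hsub : ((Node00.cubeIndices P s).filter fun c => z ∈ Node00.cubeEnl P s c n) ⊆ box.image img := by
    intro c hc
    rw [Finset.mem_filter] at hc
    obtain ⟨e, he, hce⟩ := exists_offset_of_mem_cubeEnl hs hdiv hc.1 hc.2
    rw [Finset.mem_image]
    refine ⟨e, ?_, funext fun i => (hce i).symm⟩
    rw [hbox, Fintype.mem_piFinset]
    exact fun i => Finset.mem_Icc.2 (he i)
  have hcard : box.card = (2 * n + 1) ^ P.d := by
    rw [hbox, Fintype.card_piFinset, Finset.prod_const, Finset.card_univ, Fintype.card_fin, Int.card_Icc]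
    congr 1
    omega
  calc ((Node00.cubeIndices P s).filter fun c => z ∈ Node00.cubeEnl P s c n).card
      ≤ (box.image img).card := Finset.card_le_card hsub
    _ ≤ box.card := Finset.card_image_le
    _ = (2 * n + 1) ^ P.d := hcard

/-- ★★ (C5) **THE ENTROPY COUNT OF THE GEOMETRIC ON-SET**: on the torus with `s ∣ N₀`, the number of partition cubes whose `n`-layer enlargement meets a site set `Z`
is at most `(2n+1)^d` times the number of partition cubes meeting `Z`. [cite: Balaban1988Convergent, (2.17) p.257; Balaban1989LargeFieldI, (0.3) p.176 (bookkeeping)] -/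
theorem card_onCubes_le {s : ℕ} (hs : 0 < s) (hdiv : s ∣ P.sitesPerDir 0) (n : ℕ) (Z : Set (Site P 0))
    [DecidablePred fun c : Pt P.d => ∃ z ∈ Z, z ∈ Node00.cubeEnl P s c n]
    [DecidablePred fun c : Pt P.d => ∃ z ∈ Z, z ∈ Node00.cubeEnl P s c 0] :
    ((Node00.cubeIndices P s).filter fun c => ∃ z ∈ Z, z ∈ Node00.cubeEnl P s c n).card
      ≤ (2 * n + 1) ^ P.d * ((Node00.cubeIndices P s).filter fun c => ∃ z ∈ Z, z ∈ Node00.cubeEnl P s c 0).card := by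
  classical
  set M := (Node00.cubeIndices P s).filter fun c => ∃ z ∈ Z, z ∈ Node00.cubeEnl P s c 0 with hM
  set box : Finset (Pt P.d) := Fintype.piFinset fun _ : Fin P.d => Finset.Icc (-(n : ℤ)) n with hbox
  set nb : Pt P.d → Finset (Pt P.d) := fun c₀ => box.image fun e i => (c₀ i + e i) % ((P.sitesPerDir 0 / s : ℕ) : ℤ) with hnb
  have hsub : ((Node00.cubeIndices P s).filter fun c => ∃ z ∈ Z, z ∈ Node00.cubeEnl P s c n) ⊆ M.biUnion nb := by
    intro c hc
    rw [Finset.mem_filter] at hc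
    obtain ⟨z, hzZ, hz⟩ := hc.2
    obtain ⟨e, he, hce⟩ := exists_offset_of_mem_cubeEnl hs hdiv hc.1 hz
    rw [Finset.mem_biUnion]
    refine ⟨cubeOfSite s z, ?_, ?_⟩
    · rw [hM, Finset.mem_filter]
      exact ⟨cubeOfSite_mem_cubeIndices s hs z, z, hzZ, mem_cubeEnl_cubeOfSite s hs z⟩
    · rw [hnb, Finset.mem_image]
      refine ⟨e, ?_, funext fun i => (hce i).symm⟩
      rw [hbox, Fintype.mem_piFinset]
      exact fun i => Finset.mem_Icc.2 (he i)
  have hcard : box.card = (2 * n + 1) ^ P.d := by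
    rw [hbox, Fintype.card_piFinset, Finset.prod_const, Finset.card_univ, Fintype.card_fin, Int.card_Icc]
    congr 1
    omega
  calc ((Node00.cubeIndices P s).filter fun c => ∃ z ∈ Z, z ∈ Node00.cubeEnl P s c n).card
      ≤ (M.biUnion nb).card := Finset.card_le_card hsub
    _ ≤ ∑ c₀ ∈ M, (nb c₀).card := Finset.card_biUnion_le
    _ ≤ ∑ _c₀ ∈ M, (2 * n + 1) ^ P.d := Finset.sum_le_sum fun c₀ _ => Finset.card_image_le.trans_eq hcard
    _ = (2 * n + 1) ^ P.d * M.card := by rw [Finset.sum_const, smul_eq_mul, mul_comm]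

/-- (C5′) The instance of files 31∕32: the ON-set «`□^{≈7}` meets `Z`» has at most `15^d` times as many cubes as meet `Z`.
[cite: Balaban1988Convergent, (2.17) p.257; Balaban1989LargeFieldI, (0.3) p.176 (bookkeeping)] -/
theorem card_onCubes_seven_le {s : ℕ} (hs : 0 < s) (hdiv : s ∣ P.sitesPerDir 0) (Z : Set (Site P 0))
    [DecidablePred fun c : Pt P.d => ∃ z ∈ Z, z ∈ Node00.cubeEnl P s c 7]
    [DecidablePred fun c : Pt P.d => ∃ z ∈ Z, z ∈ Node00.cubeEnl P s c 0] :
    ((Node00.cubeIndices P s).filter fun c => ∃ z ∈ Z, z ∈ Node00.cubeEnl P s c 7).card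
      ≤ 15 ^ P.d * ((Node00.cubeIndices P s).filter fun c => ∃ z ∈ Z, z ∈ Node00.cubeEnl P s c 0).card := by
  have h := card_onCubes_le hs hdiv 7 Z
  norm_num at h
  exact h

end Summit.QuantumFields.YangMills.Theorems.N21OnCubeCount
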